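import Mathlib
import Summits.NavierStokesRegularity.NavierStokesRegularity.Theorems.StretchingWellBindingDssProfileBindingSlice
import Summits.NavierStokesRegularity.NavierStokesRegularity.Theorems.TypeICertificateLadderRungReynoldsOneAprioriDecay
import Literature.Analysis.FluidPDE.ClassicalL2Stability
import Literature.Analysis.FluidPDE.VorticityEquation
import Literature.Analysis.FluidPDE.NSVorticityBKMTools
import Literature.Analysis.FluidPDE.TaoLocalisationProofs
import HarnessLib

/-!
# Route StretchingWellBinding — support item `BindingCriterion` (stmt-NavierStokesRegularity-1577),
  helper file 1/3: the vorticity-enstrophy balance on a closed slab in Tao's smooth `H¹` class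

For a classical solution `(u, q)` of unforced Navier–Stokes (viscosity `ν`) on a CLOSED slab
`[0, T'] × ℝ³` in the `L²`-Sobolev class of Tao's smooth theory (`u` and `∂ₜu` have all `L²` Sobolev
norms bounded on `[0, T']` — what `RungReynoldsOne.stub_taoCover` supplies on every closed sub-slab
of the Fefferman class), the vorticity enstrophy `Z(t) = ∫ ‖curl u(t)‖²` is continuous on `[0, T']`
and satisfies the balance
`Z(b) = Z(0) + ∫₀ᵇ 2 (∫⟪ω, Du ω⟫ − ν ∫|∇ω|²_F) dt`, `0 < b ≤ T'`
(`vorticity_balance`): the tree's order-zero balance `IsSmoothSpaceTimeOn.l2_balance` applied to the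
jointly smooth field `ω = curl u` (its time derivative `∂ₜω = curl ∂ₜu` is `L^∞_t L²_x`), followed on
each slice by the vorticity equation (`IsClassicalNSSolutionOn.isVorticitySolutionOn_Icc`) and the
whole-space integrations by parts `∫⟪Δω, ω⟫ = −∫|∇ω|²_F`, `∫⟪(u·∇)ω, ω⟫ = 0` under integrability only
(`integral_enstrophyPairing_eq_of_integrable`; integrability from the `L²` bounds on `D¹u, D²u, D³u`
and the Sobolev sup bounds on `u, Du`, `sliceIntegrable_of_sqIntegrable`). Majda–Bertozzi §2.4 /
Lemarié-Rieusset (7.20) folklore, in the vorticity variable.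

HONEST FRAMING: bookkeeping about a HYPOTHETICAL classical solution; nothing here bears on
Navier–Stokes regularity. Lands `--supports stmt-NavierStokesRegularity-1577` (other route;
label-free; typer seat g19 of cell pub-ns-dss, idle-row item).
-/

noncomputable section

set_option linter.dupNamespace false

namespace Summit.NavierStokesRegularity.NavierStokesRegularity.Theorems.DssBinding

open MeasureTheory Set Filter Topology Module Metric InnerProductSpace Function
open scoped RealInnerProductSpace Laplacian ContDiff ENNReal NNReal
open Literature.Analysis Literature.Analysis.FluidPDE
open Summit.NavierStokesRegularity.NavierStokesRegularity.Theorems.SimilarityEnstrophy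
open Summit.NavierStokesRegularity.NavierStokesRegularity.Theorems.RungReynoldsOne

/-! ### Weight-free pointwise bounds for the vorticity of a smooth slice -/

section Pointwise

variable {w : EuclideanSpace ℝ (Fin 3) → EuclideanSpace ℝ (Fin 3)}

/-- `‖curl w(x)‖ ≤ ‖curl‖ ‖D¹w(x)‖`. [folklore] -/
theorem norm_curl_le_norm_iteratedFDeriv_one (w : EuclideanSpace ℝ (Fin 3) → EuclideanSpace ℝ (Fin 3))
    (x : EuclideanSpace ℝ (Fin 3)) : ‖curl w x‖ ≤ ‖curlCLM‖ * ‖iteratedFDeriv ℝ 1 w x‖ := by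
  rw [norm_iteratedFDeriv_one]; exact norm_curl_le w x

/-- `‖D(curl w)(x)‖ ≤ ‖curl‖ ‖D²w(x)‖` for `w ∈ C^∞`. [folklore] -/
theorem norm_fderiv_curl_le_norm_iteratedFDeriv_two (hw : ContDiff ℝ ∞ w)
    (x : EuclideanSpace ℝ (Fin 3)) :
    ‖fderiv ℝ (curl w) x‖ ≤ ‖curlCLM‖ * ‖iteratedFDeriv ℝ 2 w x‖ := by
  have hw3 : ContDiff ℝ 3 w := hw.of_le (by norm_cast)
  have hd : DifferentiableAt ℝ (fderiv ℝ w) x :=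
    ((hw3.fderiv_right (m := 2) (by norm_cast)).differentiable (by norm_num)) x
  have hD : fderiv ℝ (curl w) x = curlCLM.comp (fderiv ℝ (fderiv ℝ w) x) := by
    rw [curl_eq_curlCLM_comp]
    exact (curlCLM.hasFDerivAt.comp x hd.hasFDerivAt).fderiv
  rw [hD]
  refine (ContinuousLinearMap.opNorm_comp_le _ _).trans (mul_le_mul_of_nonneg_left ?_ (norm_nonneg _))
  rw [← norm_iteratedFDeriv_one, norm_iteratedFDeriv_fderiv]

/-- `‖Δ(curl w)(x)‖ ≤ 3 ‖curl‖ ‖D³w(x)‖` for `w ∈ C^∞`. [folklore] -/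
theorem norm_laplacian_curl_le_norm_iteratedFDeriv_three (hw : ContDiff ℝ ∞ w)
    (x : EuclideanSpace ℝ (Fin 3)) :
    ‖(Δ (curl w)) x‖ ≤ 3 * ‖curlCLM‖ * ‖iteratedFDeriv ℝ 3 w x‖ := by
  have hw4 : ContDiff ℝ 4 w := hw.of_le (by norm_cast)
  have hf3 : ContDiff ℝ 3 (fderiv ℝ w) := hw4.fderiv_right (m := 3) (by norm_cast)
  have hDD : ‖fderiv ℝ (fderiv ℝ (curl w)) x‖ ≤ ‖curlCLM‖ * ‖iteratedFDeriv ℝ 3 w x‖ := by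
    rw [← norm_iteratedFDeriv_one, norm_iteratedFDeriv_fderiv, curl_eq_curlCLM_comp,
      curlCLM.iteratedFDeriv_comp_left (hf3.contDiffAt) (by norm_cast)]
    refine (ContinuousLinearMap.norm_compContinuousMultilinearMap_le _ _).trans
      (mul_le_mul_of_nonneg_left ?_ (norm_nonneg _))
    rw [norm_iteratedFDeriv_fderiv]
  have h := FluidPDE.norm_laplacian_le (curl w) x
  rw [finrank_euclideanSpace_fin] at h
  calc ‖(Δ (curl w)) x‖ ≤ 3 * ‖fderiv ℝ (fderiv ℝ (curl w)) x‖ := by exact_mod_cast h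
    _ ≤ 3 * (‖curlCLM‖ * ‖iteratedFDeriv ℝ 3 w x‖) := by gcongr
    _ = 3 * ‖curlCLM‖ * ‖iteratedFDeriv ℝ 3 w x‖ := by ring

end Pointwise

/-! ### The slice identity under integrability only -/

section SliceIdentity

variable {w : EuclideanSpace ℝ (Fin 3) → EuclideanSpace ℝ (Fin 3)}

/-- **The slice identity under integrability hypotheses.** For a smooth, bounded, divergence-free
slice `w` whose vorticity `ω = curl w` has `|ω|², |∇ω|²_F, ⟪Δω, ω⟫, ⟪(w·∇)ω, ω⟫, ⟪ω, Dw ω⟫ ∈ L¹`: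
`∫ 2⟪ω, νΔω − Dω(w) + Dw(ω)⟫ = 2(∫⟪ω, Dw ω⟫ − ν∫|∇ω|²_F)` (the Green identity and incompressible
transport on the whole space under integrability only — the cell pub-ns-dss tools
`SimilarityEnstrophy.integral_inner_laplacian_self_eq_neg_integral_frobeniusNormSq`,
`SimilarityEnstrophy.integral_inner_convect_self_eq_zero`; the decay form is
`integral_enstrophyPairing_eq`). [folklore] -/
theorem integral_enstrophyPairing_eq_of_integrable (hw : ContDiff ℝ ∞ w)
    (hdiv : VectorCalculus.IsDivFree w) (ν : ℝ) {M : ℝ} (h0 : ∀ x, ‖w x‖ ≤ M)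
    (iZ : Integrable fun x => ‖curl w x‖ ^ 2)
    (iF : Integrable fun x => frobeniusNormSq (fderiv ℝ (curl w) x))
    (iL : Integrable fun x => ⟪(Δ (curl w)) x, curl w x⟫)
    (iT : Integrable fun x => ⟪convect w (curl w) x, curl w x⟫)
    (iS : Integrable fun x => ⟪curl w x, fderiv ℝ w x (curl w x)⟫) :
    ∫ x, 2 * ⟪curl w x,
        ν • (Δ (curl w)) x - fderiv ℝ (curl w) x (w x) + fderiv ℝ w x (curl w x)⟫ =
      2 * ((∫ x, ⟪curl w x, fderiv ℝ w x (curl w x)⟫)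
        - ν * ∫ x, frobeniusNormSq (fderiv ℝ (curl w) x)) := by
  have hω : ContDiff ℝ ∞ (curl w) := contDiff_curl_smooth hw
  have hL := integral_inner_laplacian_self_eq_neg_integral_frobeniusNormSq hω iZ iF iL
  have hT := integral_inner_convect_self_eq_zero hω hw hdiv h0 iZ iT
  have hpt : ∀ x, 2 * ⟪curl w x,
      ν • (Δ (curl w)) x - fderiv ℝ (curl w) x (w x) + fderiv ℝ w x (curl w x)⟫ =
      2 * ν * ⟪(Δ (curl w)) x, curl w x⟫ - 2 * ⟪convect w (curl w) x, curl w x⟫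
        + 2 * ⟪curl w x, fderiv ℝ w x (curl w x)⟫ := by
    intro x
    have e1 : ⟪curl w x, (Δ (curl w)) x⟫ = ⟪(Δ (curl w)) x, curl w x⟫ := real_inner_comm _ _
    have e3 : ⟪curl w x, fderiv ℝ (curl w) x (w x)⟫ = ⟪convect w (curl w) x, curl w x⟫ := by
      simp only [convect]; exact real_inner_comm _ _
    simp only [inner_sub_right, inner_add_right, real_inner_smul_right, e1, e3]
    ring
  simp_rw [hpt]
  rw [integral_add ?_ (iS.const_mul 2), integral_sub (iL.const_mul (2 * ν)) (iT.const_mul 2),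
    integral_const_mul, integral_const_mul, integral_const_mul, hL, hT]
  · ring
  · exact (iL.const_mul (2 * ν)).sub (iT.const_mul 2)

/-- **Slice integrability in the `L²`-Sobolev class.** For a smooth slice `w` with
`‖w‖ ≤ B₀`, `‖Dw‖ ≤ B₁` and `‖D¹w‖², ‖D²w‖², ‖D³w‖² ∈ L¹(ℝ³)`, the five enstrophy-budget pairings of
`ω = curl w` are integrable (`|ab| ≤ (a² + b²)/2`). [folklore] -/
theorem sliceIntegrable_of_sqIntegrable (hw : ContDiff ℝ ∞ w) {B₀ B₁ : ℝ}
    (h0 : ∀ x, ‖w x‖ ≤ B₀) (h1 : ∀ x, ‖fderiv ℝ w x‖ ≤ B₁)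
    (i1 : Integrable fun x => ‖iteratedFDeriv ℝ 1 w x‖ ^ 2)
    (i2 : Integrable fun x => ‖iteratedFDeriv ℝ 2 w x‖ ^ 2)
    (i3 : Integrable fun x => ‖iteratedFDeriv ℝ 3 w x‖ ^ 2) :
    (Integrable fun x => ‖curl w x‖ ^ 2) ∧
    (Integrable fun x => frobeniusNormSq (fderiv ℝ (curl w) x)) ∧
    (Integrable fun x => ⟪(Δ (curl w)) x, curl w x⟫) ∧
    (Integrable fun x => ⟪convect w (curl w) x, curl w x⟫) ∧
    (Integrable fun x => ⟪curl w x, fderiv ℝ w x (curl w x)⟫) := by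
  have hω : ContDiff ℝ ∞ (curl w) := contDiff_curl_smooth hw
  have hB₀ : 0 ≤ B₀ := (norm_nonneg _).trans (h0 0)
  have hB₁ : 0 ≤ B₁ := (norm_nonneg _).trans (h1 0)
  set c : ℝ := ‖(curlCLM : (EuclideanSpace ℝ (Fin 3) →L[ℝ] EuclideanSpace ℝ (Fin 3)) →L[ℝ]
    EuclideanSpace ℝ (Fin 3))‖ with hc
  have hc0 : 0 ≤ c := by rw [hc]; positivity
  -- pointwise bounds
  have pZ : ∀ x, ‖curl w x‖ ^ 2 ≤ c ^ 2 * ‖iteratedFDeriv ℝ 1 w x‖ ^ 2 := fun x => by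
    rw [← mul_pow]
    exact pow_le_pow_left₀ (norm_nonneg _) (norm_curl_le_norm_iteratedFDeriv_one w x) 2
  have pD : ∀ x, ‖fderiv ℝ (curl w) x‖ ^ 2 ≤ c ^ 2 * ‖iteratedFDeriv ℝ 2 w x‖ ^ 2 := fun x => by
    rw [← mul_pow]
    exact pow_le_pow_left₀ (norm_nonneg _) (norm_fderiv_curl_le_norm_iteratedFDeriv_two hw x) 2
  have pL : ∀ x, ‖(Δ (curl w)) x‖ ^ 2 ≤ (3 * c) ^ 2 * ‖iteratedFDeriv ℝ 3 w x‖ ^ 2 := fun x => by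
    rw [← mul_pow]
    exact pow_le_pow_left₀ (norm_nonneg _) (norm_laplacian_curl_le_norm_iteratedFDeriv_three hw x) 2
  -- continuity of the integrands
  have cZ : Continuous fun x => ‖curl w x‖ ^ 2 := (hω.continuous.norm).pow 2
  have cF : Continuous fun x => frobeniusNormSq (fderiv ℝ (curl w) x) := by
    unfold frobeniusNormSq
    exact continuous_finsetSum _ fun i _ =>
      (((hω.continuous_fderiv (by simp)).clm_apply continuous_const).norm).pow 2
  have cL : Continuous fun x => ⟪(Δ (curl w)) x, curl w x⟫ :=
    (continuous_laplacian (hω.of_le (by norm_cast))).inner hω.continuous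
  have cT : Continuous fun x => ⟪convect w (curl w) x, curl w x⟫ := by
    simp only [convect]
    exact ((hω.continuous_fderiv (by simp)).clm_apply hw.continuous).inner hω.continuous
  have cS : Continuous fun x => ⟪curl w x, fderiv ℝ w x (curl w x)⟫ :=
    hω.continuous.inner ((hw.continuous_fderiv (by simp)).clm_apply hω.continuous)
  have iZ : Integrable fun x => ‖curl w x‖ ^ 2 :=
    (i1.const_mul (c ^ 2)).mono' cZ.aestronglyMeasurable (Eventually.of_forall fun x => by
      rw [Real.norm_of_nonneg (sq_nonneg _)]; exact pZ x)
  refine ⟨iZ, ?_, ?_, ?_, ?_⟩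
  · refine (i2.const_mul (3 * c ^ 2)).mono' cF.aestronglyMeasurable (Eventually.of_forall fun x => ?_)
    rw [Real.norm_of_nonneg (frobeniusNormSq_nonneg _)]
    calc frobeniusNormSq (fderiv ℝ (curl w) x) ≤ 3 * ‖fderiv ℝ (curl w) x‖ ^ 2 :=
          frobeniusNormSq_le_three_mul _
      _ ≤ 3 * (c ^ 2 * ‖iteratedFDeriv ℝ 2 w x‖ ^ 2) := by gcongr; exact pD x
      _ = 3 * c ^ 2 * ‖iteratedFDeriv ℝ 2 w x‖ ^ 2 := by ring
  · refine ((i3.const_mul ((3 * c) ^ 2 / 2)).add (i1.const_mul (c ^ 2 / 2))).mono' cL.aestronglyMeasurable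
      (Eventually.of_forall fun x => ?_)
    have h := norm_inner_le_norm (𝕜 := ℝ) ((Δ (curl w)) x) (curl w x)
    have hsq : ‖(Δ (curl w)) x‖ * ‖curl w x‖ ≤
        (‖(Δ (curl w)) x‖ ^ 2 + ‖curl w x‖ ^ 2) / 2 := by
      nlinarith [sq_nonneg (‖(Δ (curl w)) x‖ - ‖curl w x‖)]
    have := pL x; have := pZ x
    simp only [Pi.add_apply]
    linarith
  · refine ((i2.const_mul (B₀ * c ^ 2 / 2)).add (i1.const_mul (B₀ * c ^ 2 / 2))).mono'
      cT.aestronglyMeasurable (Eventually.of_forall fun x => ?_)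
    simp only [convect, Pi.add_apply]
    have h := norm_inner_le_norm (𝕜 := ℝ) (fderiv ℝ (curl w) x (w x)) (curl w x)
    have h' : ‖fderiv ℝ (curl w) x (w x)‖ ≤ ‖fderiv ℝ (curl w) x‖ * B₀ :=
      (ContinuousLinearMap.le_opNorm _ _).trans (mul_le_mul_of_nonneg_left (h0 x) (norm_nonneg _))
    have hsq : ‖fderiv ℝ (curl w) x‖ * ‖curl w x‖ ≤
        (‖fderiv ℝ (curl w) x‖ ^ 2 + ‖curl w x‖ ^ 2) / 2 := by
      nlinarith [sq_nonneg (‖fderiv ℝ (curl w) x‖ - ‖curl w x‖)]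
    have e1 := pD x; have e2 := pZ x
    have h3 : ‖⟪fderiv ℝ (curl w) x (w x), curl w x⟫‖ ≤ B₀ * (‖fderiv ℝ (curl w) x‖ * ‖curl w x‖) := by
      calc ‖⟪fderiv ℝ (curl w) x (w x), curl w x⟫‖ ≤ ‖fderiv ℝ (curl w) x (w x)‖ * ‖curl w x‖ := h
        _ ≤ (‖fderiv ℝ (curl w) x‖ * B₀) * ‖curl w x‖ := mul_le_mul_of_nonneg_right h' (norm_nonneg _)
        _ = B₀ * (‖fderiv ℝ (curl w) x‖ * ‖curl w x‖) := by ring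
    have h4 : B₀ * (‖fderiv ℝ (curl w) x‖ * ‖curl w x‖) ≤
        B₀ * ((c ^ 2 * ‖iteratedFDeriv ℝ 2 w x‖ ^ 2 + c ^ 2 * ‖iteratedFDeriv ℝ 1 w x‖ ^ 2) / 2) :=
      mul_le_mul_of_nonneg_left (hsq.trans (by linarith)) hB₀
    linarith
  · refine (i1.const_mul (B₁ * c ^ 2)).mono' cS.aestronglyMeasurable (Eventually.of_forall fun x => ?_)
    have h := norm_inner_le_norm (𝕜 := ℝ) (curl w x) (fderiv ℝ w x (curl w x))
    have h' : ‖fderiv ℝ w x (curl w x)‖ ≤ B₁ * ‖curl w x‖ :=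
      (ContinuousLinearMap.le_opNorm _ _).trans (mul_le_mul_of_nonneg_right (h1 x) (norm_nonneg _))
    have e2 := pZ x
    calc ‖⟪curl w x, fderiv ℝ w x (curl w x)⟫‖ ≤ ‖curl w x‖ * ‖fderiv ℝ w x (curl w x)‖ := h
      _ ≤ ‖curl w x‖ * (B₁ * ‖curl w x‖) := mul_le_mul_of_nonneg_left h' (norm_nonneg _)
      _ = B₁ * ‖curl w x‖ ^ 2 := by ring
      _ ≤ B₁ * (c ^ 2 * ‖iteratedFDeriv ℝ 1 w x‖ ^ 2) := mul_le_mul_of_nonneg_left e2 hB₁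
      _ = B₁ * c ^ 2 * ‖iteratedFDeriv ℝ 1 w x‖ ^ 2 := by ring

end SliceIdentity

/-! ### The vorticity-enstrophy balance on a closed slab -/

section Balance

variable {ν T' : ℝ} {u : ℝ → EuclideanSpace ℝ (Fin 3) → EuclideanSpace ℝ (Fin 3)}
  {q : ℝ → EuclideanSpace ℝ (Fin 3) → ℝ}

/-- `‖f‖² ∈ L¹` for a continuous slice with `∫⁻ ‖f‖ₑ² ≤ C`. [folklore] -/
theorem integrable_sq_norm_of_lintegral_le {F : Type*} [NormedAddCommGroup F]
    {f : EuclideanSpace ℝ (Fin 3) → F} (hf : Continuous f) {C : ℝ≥0}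
    (h : ∫⁻ x, ‖f x‖ₑ ^ 2 ≤ C) : Integrable fun x => ‖f x‖ ^ 2 :=
  FluidPDE.integrable_sq_norm_of_lintegral_lt_top hf (h.trans_lt ENNReal.coe_lt_top)

/-- **The vorticity-enstrophy balance in Tao's class on `[0, T']`.** Let `(u, q)` be a classical
solution of unforced Navier–Stokes (viscosity `ν`) on `ℝ³ × [0, T']`, `0 < T'`, with `u` and `∂ₜu`
(one-sided within `[0, T']`) having all `L²` Sobolev norms bounded on `[0, T']`. Then
`Z(t) = ∫ ‖curl u(t)‖²` is continuous on `[0, T']` and for every `b ∈ (0, T']`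
`Z(b) = Z(0) + ∫₀ᵇ 2(∫⟪ω, Du ω⟫ − ν∫|∇ω|²_F) dt`, the integrand being integrable on `(0, T')`
(order-zero balance `IsSmoothSpaceTimeOn.l2_balance` for `ω = curl u`, `∂ₜω = curl ∂ₜu`; vorticity
equation on the closed slab; slice identity under integrability). [folklore] -/
theorem vorticity_balance (hT' : 0 < T') (hsol : IsClassicalNSSolutionOn (Icc 0 T') ν 0 u q)
    (hB : HasBoundedSobolevNormsOn (Icc 0 T') u)
    (hBt : HasBoundedSobolevNormsOn (Icc 0 T') (timeDerivWithin (Icc 0 T') u)) :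
    ContinuousOn (fun t => ∫ x, ‖curl (u t) x‖ ^ 2) (Icc 0 T') ∧
    IntegrableOn (fun t => 2 * ((∫ x, ⟪curl (u t) x, fderiv ℝ (u t) x (curl (u t) x)⟫)
      - ν * ∫ x, frobeniusNormSq (fderiv ℝ (curl (u t)) x))) (Ioo 0 T') ∧
    ∀ b ∈ Ioc 0 T', ∫ x, ‖curl (u b) x‖ ^ 2 =
      (∫ x, ‖curl (u 0) x‖ ^ 2) +
        ∫ t in (0 : ℝ)..b, 2 * ((∫ x, ⟪curl (u t) x, fderiv ℝ (u t) x (curl (u t) x)⟫)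
          - ν * ∫ x, frobeniusNormSq (fderiv ℝ (curl (u t)) x)) := by
  have hU : UniqueDiffOn ℝ (Icc 0 T') := uniqueDiffOn_Icc hT'
  have hcl : Icc 0 T' ⊆ closure (interior (Icc 0 T')) := by
    rw [interior_Icc, closure_Ioo hT'.ne]
  have hsm : IsSmoothSpaceTimeOn (Icc 0 T') u := hsol.smooth_velocity
  have hu : ∀ t ∈ Icc 0 T', ContDiff ℝ ∞ (u t) := fun t ht => hsol.contDiff_velocity ht
  -- the vorticity as a jointly smooth field on the closed slab
  have hvort : IsSmoothSpaceTimeOn (Icc 0 T') (vorticity u) := by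
    have h1 := (hsm.fderiv_slice hU).clm curlCLM
    have e : (fun t x => curlCLM (fderiv ℝ (u t) x)) = vorticity u := by funext s y; rfl
    rwa [e] at h1
  -- `L²` bounds on `ω` and `∂ₜω = curl ∂ₜu`
  obtain ⟨C₁, hC₁⟩ := hB 1
  obtain ⟨D₁, hD₁⟩ := hBt 1
  have hω2 : ∀ t ∈ Icc 0 T', ∫⁻ x, ‖vorticity u t x‖ₑ ^ 2 ≤ 6 * C₁ := by
    intro t ht
    calc ∫⁻ x, ‖vorticity u t x‖ₑ ^ 2 ≤ ∫⁻ x, 6 * ‖iteratedFDeriv ℝ 1 (u t) x‖ₑ ^ 2 :=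
          lintegral_mono fun x => by rw [vorticity_apply]; exact enorm_curl_sq_le_six_mul (u t) x
      _ = 6 * ∫⁻ x, ‖iteratedFDeriv ℝ 1 (u t) x‖ₑ ^ 2 := lintegral_const_mul' _ _ (by norm_num)
      _ ≤ 6 * C₁ := by gcongr; exact hC₁ t ht
  have hωt2 : ∀ t ∈ Icc 0 T',
      ∫⁻ x, ‖timeDerivWithin (Icc 0 T') (vorticity u) t x‖ₑ ^ 2 ≤ 6 * D₁ := by
    intro t ht
    calc ∫⁻ x, ‖timeDerivWithin (Icc 0 T') (vorticity u) t x‖ₑ ^ 2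
        ≤ ∫⁻ x, 6 * ‖iteratedFDeriv ℝ 1 (timeDerivWithin (Icc 0 T') u t) x‖ₑ ^ 2 :=
          lintegral_mono fun x => by
            rw [← hsm.curl_timeDerivWithin hU hcl ht x]
            exact enorm_curl_sq_le_six_mul (timeDerivWithin (Icc 0 T') u t) x
      _ = 6 * ∫⁻ x, ‖iteratedFDeriv ℝ 1 (timeDerivWithin (Icc 0 T') u t) x‖ₑ ^ 2 :=
          lintegral_const_mul' _ _ (by norm_num)
      _ ≤ 6 * D₁ := by gcongr; exact hD₁ t ht
  have hbal := IsSmoothSpaceTimeOn.l2_balance hT' hvort (C₀ := 6 * C₁) (C₁ := 6 * D₁)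
    (fun t ht => by exact_mod_cast hω2 t ht) (fun t ht => by exact_mod_cast hωt2 t ht)
  obtain ⟨hΦint, hZcont, hZeq⟩ := hbal
  -- the slice identity `∫ 2⟪ω, ∂ₜω⟫ = 2(∫⟪ω, Du ω⟫ − ν ∫|∇ω|²_F)` on `[0, T']`
  have hV := hsol.isVorticitySolutionOn_Icc hT'.ne' (fun _ _ x => curl_zero x)
  obtain ⟨B₀, hB₀⟩ := linfty_bound_of_hasBoundedSobolevNormsOn_holds
    (fun t ht => (hu t ht).of_le (by norm_cast)) hB
  obtain ⟨B₁, -, hB₁⟩ := exists_forall_norm_iteratedFDeriv_le_bkmClass hu hB 1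
  obtain ⟨C₂, hC₂⟩ := hB 2
  obtain ⟨C₃, hC₃⟩ := hB 3
  have hslice : ∀ t ∈ Icc 0 T',
      ∫ x, 2 * ⟪vorticity u t x, timeDerivWithin (Icc 0 T') (vorticity u) t x⟫ =
        2 * ((∫ x, ⟪curl (u t) x, fderiv ℝ (u t) x (curl (u t) x)⟫)
          - ν * ∫ x, frobeniusNormSq (fderiv ℝ (curl (u t)) x)) := by
    intro t ht
    have hveq : ∀ x, timeDerivWithin (Icc 0 T') (vorticity u) t x =
        ν • (Δ (curl (u t))) x - fderiv ℝ (curl (u t)) x (u t x) + fderiv ℝ (u t) x (curl (u t) x) := by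
      intro x
      have h := hV.vorticity_eq t ht x
      simp only [convect_apply, vorticity_apply] at h
      calc timeDerivWithin (Icc 0 T') (vorticity u) t x
          = (fderiv ℝ (u t) x (curl (u t) x) + ν • (Δ (curl (u t))) x)
              - fderiv ℝ (curl (u t)) x (u t x) := by
            rw [← h]; abel
        _ = _ := by abel
    have h1i : ∀ x, ‖fderiv ℝ (u t) x‖ ≤ B₁ := fun x => by
      rw [← norm_iteratedFDeriv_one]; exact hB₁ t ht x
    obtain ⟨iZ, iF, iL, iT, iS⟩ := sliceIntegrable_of_sqIntegrable (hu t ht) (hB₀ t ht) h1i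
      (integrable_sq_norm_of_lintegral_le
        (ContDiff.continuous_iteratedFDeriv (m := 1) (by simp) (hu t ht)) (hC₁ t ht))
      (integrable_sq_norm_of_lintegral_le
        (ContDiff.continuous_iteratedFDeriv (m := 2) (by norm_cast) (hu t ht)) (hC₂ t ht))
      (integrable_sq_norm_of_lintegral_le
        (ContDiff.continuous_iteratedFDeriv (m := 3) (by norm_cast) (hu t ht)) (hC₃ t ht))
    have hid := integral_enstrophyPairing_eq_of_integrable (hu t ht) (hsol.divFree t ht) ν
      (hB₀ t ht) iZ iF iL iT iS
    rw [← hid]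
    refine integral_congr_ae (Eventually.of_forall fun x => ?_)
    simp only [vorticity_apply, hveq x]
  refine ⟨?_, ?_, fun b hb => ?_⟩
  · refine hZcont.congr fun t _ => ?_
    simp only [vorticity_apply]
  · refine (hΦint.congr_fun (fun t ht => hslice t (Ioo_subset_Icc_self ht)) measurableSet_Ioo)
  · have h := hZeq b hb
    simp only [vorticity_apply] at h
    rw [h]
    congr 1
    refine intervalIntegral.integral_congr_ae (Eventually.of_forall fun t ht => ?_)
    rw [uIoc_of_le hb.1.le] at ht
    have h' := hslice t ⟨ht.1.le, ht.2.trans hb.2⟩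
    simp only [vorticity_apply] at h'
    exact h'

end Balance

end Summit.NavierStokesRegularity.NavierStokesRegularity.Theorems.DssBinding

end
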